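import Summits.QuantumFields.YangMills.Theses.FradkinShenkerFlow
import Literature.Probability.LatticeModels.TransferOperator

/-!
# Sketch — crux-ideate `stmt-QuantumFields-9442` (`FiniteSusceptibilityWeakCoupling`), ideator 3, round 1

First lemmas (statements only, `def … : Prop`) of the two crux idea cards

* `axial-mirror-moments` : `TraceCauchySchwarz`, `AxialCubicMoment`, `AxialCubicMomentAxis0`,
  `AxialCubicMomentToSusceptibility`;
* `two-slice-weak-poincare` : `WeakPoincareDecay`, `TwoSliceWeakPoincare`,
  `TwoSliceWeakPoincareToAxialMoment`.

Nothing here is an item; the crux decl is used BY NAME as the conclusion of the transfers.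
-/

namespace Summit.QuantumFields.YangMills.Cruxes.FiniteSusceptibilityWeakCoupling.Sketch

open scoped BigOperators InnerProductSpace ComplexOrder Matrix
open MeasureTheory Literature.MathematicalPhysics.QuantumFieldTheory
  Literature.MathematicalPhysics.QuantumLattice Literature.Probability.LatticeModels

/-! ## Card `axial-mirror-moments` -/

/-- **Abstract core (PROVED: `traceCauchySchwarz_holds`, TraceCS.lean / TraceCSIdeator3.lean): Hilbert–Schmidt Cauchy–Schwarz for ring traces.**
For a positive semidefinite `T` (the transfer matrix of the odd torus, `T ≥ 0` by site+link
reflection positivity), the "off-diagonal" ring trace `Tr(T^m F T^n G)` — the torus expectation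
`⟨A · B∘τ_(n,x⃗)⟩` once `G` is conjugated by the unitary spatial translation, which commutes with
`T` and drops out — is dominated by the two DIAGONAL traces `Tr(T^m F T^n Fᴴ)`, `Tr(T^m Gᴴ T^n G)`,
which are Hilbert–Schmidt norms, hence `≥ 0`: the autocorrelation of `A` with its own time-mirror
image at lag `n`. Proof: `X := T^{m/2} F T^{n/2}`, `Y := T^{n/2} G T^{m/2}`, cyclicity and
`|Tr(XY)| ≤ ‖X‖_HS ‖Y‖_HS` (`Matrix.PosSemidef.sqrt`). -/
def TraceCauchySchwarz : Prop :=
  ∀ (k : ℕ) (T F G : Matrix (Fin k) (Fin k) ℂ), T.PosSemidef → ∀ m n : ℕ,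
    ‖(T ^ m * F * T ^ n * G).trace‖ ≤
      Real.sqrt ((T ^ m * F * T ^ n * Fᴴ).trace.re * (T ^ m * Gᴴ * T ^ n * G).trace.re)

/-- **C⁺ of card `axial-mirror-moments` (AXIAL CUBIC MOMENT CONDITION).** For compact simple `G`,
faithful unitary `r`, all `β ≥ β₀(G,r)`, every axis `μ` and every PAIR of bounded gauge-invariant
local observables, the purely AXIAL connected correlations on the torus `(ℤ/(2S+1))⁴` have a third
moment bounded uniformly in `S`: `Σ_{n ≤ S} (n+1)³ |Cov_{β,S}(A∘lift, B∘τ_{n e_μ}∘lift)| ≤ M(A,B,β)`.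
One-dimensional (axial displacements only), and — for the mirror pairs `(A, ΘA)` that the transfer
actually consumes — a statement about ONE completely monotone (Stieltjes) sequence per observable,
i.e. `∫ dν_A(λ)/(1-λ)⁴ < ∞` for the spectral measure of `A` at the bottom of the transfer-matrix
spectrum (order-4 infrared integrability), with no sign cancellations and no spatial sums. -/
def AxialCubicMoment : Prop :=
  ∀ (G : Type) [Group G] [TopologicalSpace G] [IsTopologicalGroup G] [CompactSpace G]
    [MeasurableSpace G] [BorelSpace G],
    IsCompactSimpleLieGroup G → ∀ (r : LatticeRep G), ∃ β₀ : ℝ, ∀ β : ℝ, β₀ ≤ β →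
      ∀ (μ : Fin 4) (A B : YMSpecies G), ∃ M : ℝ, ∀ S : ℕ,
        ∑ n ∈ Finset.range (S + 1), ((n : ℝ) + 1) ^ 3 *
          |ProbabilityTheory.covariance (fun U => A.F (torusLift (2 * S + 1) U))
            (fun U => B.F (configShift (-(Pi.single μ (n : ℤ))) (torusLift (2 * S + 1) U)))
            (wilsonMeasure (d := 4) (L := 2 * S + 1) r.ρ β)| ≤ M

/-- The same condition along the Euclidean-time axis only, written with the tree's
`latticeConnectedCorr` (the correlator of `HasLatticeMassGap`, with `C e^{-Δn}` replaced by
`n³`-summability); equivalent to `AxialCubicMoment` by the hyperoctahedral covariance of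
`wilsonMeasure` and of the class `YMSpecies` (coordinate permutations), a routine lemma. -/
def AxialCubicMomentAxis0 : Prop :=
  ∀ (G : Type) [Group G] [TopologicalSpace G] [IsTopologicalGroup G] [CompactSpace G]
    [MeasurableSpace G] [BorelSpace G],
    IsCompactSimpleLieGroup G → ∀ (r : LatticeRep G), ∃ β₀ : ℝ, ∀ β : ℝ, β₀ ≤ β →
      ∀ (A B : YMSpecies G), ∃ M : ℝ, ∀ S : ℕ,
        ∑ n ∈ Finset.range (S + 1), ((n : ℝ) + 1) ^ 3 *
          |latticeConnectedCorr r.ρ β (2 * S + 1) A.F B.F n| ≤ M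

/-- **TRANSFER of card `axial-mirror-moments`** (the first theorem of the line; ingredients all
in the tree or elementary: odd-torus reflection positivity `wilsonExpectation_oddReflectionPositive`
in each axis direction, Cauchy–Schwarz for the RP form with the mirror placed MIDWAY between the
two supports, spatial-translation invariance, the shell count `#{x : ‖x‖_∞ = n} ≤ 8(2n+1)³` in
`d = 4`, and Cauchy–Schwarz in `n`): the axial cubic moment condition implies the crux verbatim. -/
def AxialCubicMomentToSusceptibility : Prop :=
  AxialCubicMoment →
    Summit.QuantumFields.YangMills.Theses.FradkinShenkerFlow.FiniteSusceptibilityWeakCoupling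

/-! ## Card `two-slice-weak-poincare` -/

/-- **Abstract core (PROVED: `weakPoincareDecay_holds`, WPDecay.lean / WPDecayIdeator3.lean; discrete Röckner–Wang): a WEAK Poincaré inequality for the
transfer form gives POLYNOMIAL decay of autocorrelations.** `D : TransferData H` (positive
contraction `T`, vacuum `Ω`), `Φ ≥ 0` a `T`-monotone functional (e.g. `osc²` of the underlying
slice function: `T` is Markov after the ground-state transform). If for all `v ⊥ Ω` and all
`s > 0`, `‖v‖² ≤ C s^{-p} (‖v‖² − re⟪Tv,v⟫) + s Φ(v)`, then for every `q < 1/p`,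
`re⟪Tⁿv,v⟫ ≤ C' (n+1)^{-q} (‖v‖² + Φ v)`. (Iterate `b(k+1) ≤ (1 − sᵖ/C) b(k) + s^{1+p}Φ/C` for
`b(k) = ‖Tᵏv‖²`, using `T ≥ 0 ⇒ ⟪T^{2k+1}v,v⟫ ≥ ⟪T^{2k+2}v,v⟫`, then choose
`s = (k+1)^{-q}`: a stretched exponential beats every power, which is where `q < 1/p` enters.) With `p < 1/4` one may take
`q > 4`, so `Σ_n (n+1)³ re⟪Tⁿv,v⟫ < ∞`: exactly the mirror moments of `AxialCubicMoment`. -/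
def WeakPoincareDecay : Prop :=
  ∀ (H : Type) [NormedAddCommGroup H] [InnerProductSpace ℂ H] [CompleteSpace H]
    (D : TransferData H) (Φ : H → ℝ) (C p : ℝ), 0 < C → 0 < p →
    (∀ v, 0 ≤ Φ v) → (∀ v, Φ (D.T v) ≤ Φ v) →
    (∀ v : H, ⟪D.vacuum, v⟫_ℂ = 0 → ∀ s : ℝ, 0 < s →
        ‖v‖ ^ 2 ≤ C * s ^ (-p) * (‖v‖ ^ 2 - RCLike.re ⟪D.T v, v⟫_ℂ) + s * Φ v) →
    ∀ q : ℝ, 0 < q → q < 1 / p → ∃ C' : ℝ, ∀ v : H, ⟪D.vacuum, v⟫_ℂ = 0 → ∀ n : ℕ,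
        RCLike.re ⟪(D.T ^ n) v, v⟫_ℂ ≤ C' * ((n : ℝ) + 1) ^ (-q) * (‖v‖ ^ 2 + Φ v)

/-- **C⁺⁺ of card `two-slice-weak-poincare` (TWO-SLICE WEAK POINCARÉ INEQUALITY at weak coupling).**
For compact simple `G`, faithful unitary `r` and all `β ≥ β₀(G,r)` there are `C > 0` and an exponent
`0 < p < 1/4` such that on every torus `(ℤ/(2S+1))⁴`, for every measurable `f` with `|f| ≤ 1`
depending only on the SPATIAL links of the time-zero slice (the state of the slice Markov chain;
`osc(f)² ≤ 4` is the `s`-term), and every `s > 0`,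
`Var_{β,S}(f) ≤ C s^{-p} · ½ E_{β,S}[(f∘shift_{e₀} − f)²] + 4 s`.
The Dirichlet form `½E(f∘τ − f)²` is the EXPLICIT two-slice form of the transfer chain
(`⟪v,(1−T)v⟫` in the OS space), whose spectral gap IS the mass gap; the weak inequality with
`p < 1/4` asks only for order-`>4` polynomial relaxation, uniformly in the volume. -/
def TwoSliceWeakPoincare : Prop :=
  ∀ (G : Type) [Group G] [TopologicalSpace G] [IsTopologicalGroup G] [CompactSpace G]
    [MeasurableSpace G] [BorelSpace G],
    IsCompactSimpleLieGroup G → ∀ (r : LatticeRep G), ∃ β₀ : ℝ, ∀ β : ℝ, β₀ ≤ β →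
      ∃ C p : ℝ, 0 < C ∧ 0 < p ∧ p < 1 / 4 ∧
        ∀ (S : ℕ) (f : GaugeConfig 4 (2 * S + 1) G → ℝ), Measurable f → (∀ U, |f U| ≤ 1) →
          (∀ U V : GaugeConfig 4 (2 * S + 1) G,
              (∀ e : Edge 4 (2 * S + 1), e.1 0 = 0 → e.2 ≠ 0 → U e = V e) → f U = f V) →
          ∀ s : ℝ, 0 < s →
            ProbabilityTheory.variance f (wilsonMeasure (d := 4) (L := 2 * S + 1) r.ρ β) ≤
              C * s ^ (-p) *
                  ((1 / 2) * ∫ U, (f (fun e => U (e.1.shift 0, e.2)) - f U) ^ 2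
                    ∂(wilsonMeasure (d := 4) (L := 2 * S + 1) r.ρ β)) +
                s * 4

/-- **TRANSFER of card `two-slice-weak-poincare`**: the two-slice weak Poincaré inequality implies
the axial cubic moment condition of card `axial-mirror-moments` (hence, with
`AxialCubicMomentToSusceptibility`, the crux). Ingredients: the time-Markov property of Wilson's
nearest-neighbour-in-time measure (state = spatial links of a slice; temporal links integrate to a
gauge-invariant kernel), reduction of slab observables to slice functions by conditional
expectation, `WeakPoincareDecay`, and the ring-versus-chain comparison on the symmetric odd torus
for lags `n ≤ S` (the one genuinely torus-specific step; `T ≥ 0` from odd-torus RP). -/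
def TwoSliceWeakPoincareToAxialMoment : Prop :=
  TwoSliceWeakPoincare → AxialCubicMoment

/-- The composed line of the two cards, concluding the crux BY NAME. -/
theorem crux_of (h₁ : AxialCubicMomentToSusceptibility) (h₂ : TwoSliceWeakPoincareToAxialMoment)
    (h : TwoSliceWeakPoincare) :
    Summit.QuantumFields.YangMills.Theses.FradkinShenkerFlow.FiniteSusceptibilityWeakCoupling :=
  h₁ (h₂ h)

end Summit.QuantumFields.YangMills.Cruxes.FiniteSusceptibilityWeakCoupling.Sketch
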